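import Summits.QuantumAdvantage.QuantumAdvantage.Theses.DarkClassGroups
import Literature.Computability.Cryptography.ShorProofs
import Literature.Computability.Cryptography.HallgrenClassGroup
import HarnessLib

/-!
# Glue `ClassNumberFBQPOfPieces` (stmt-QuantumAdvantage-17903, route `DarkClassGroups`): PROVED

Topic `Summits/QuantumAdvantage/QuantumAdvantage/Theorems`; closes the support (glue) item
`Summit.QuantumAdvantage.QuantumAdvantage.Theses.DarkClassGroups.ClassNumberFBQPOfPieces`
(`NoSiegelBright → BrightClassNumberQSolvable → OrderClassNumberFormula → OrderReduction → ClassNumberFBQP`)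
BY NAME — the assembly `ClassNumberFBQP_of_subs` of the planner's `Cruxes/ClassNumberFBQP/Split.lean`
(planner-cstrat-stmt-QuantumAdvantage-11623-r1-0), written directly against the route declarations (which are
byte-identical to the pieces of `Split.lean`).  Proof (a genuine seam, not a modus ponens): under (i) take
the brightness constant `C` from `NoSiegelBright`, run `BrightClassNumberQSolvable`'s family at `C` and
`IsQSolvable.mono` to the unpromised fixed-width fundamental solver, then `OrderReduction` with
`OrderClassNumberFormula`; the parent's antecedents `PrimeClassesSpread` / `AbelianGroupOrderFBQP` are not used.
HONEST FRAMING: a kernel-checked glue lemma — not summit progress.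
-/

namespace Summit.QuantumAdvantage.QuantumAdvantage.Theorems.DarkClassGroups

open Summit.QuantumAdvantage.QuantumAdvantage.Theses.DarkClassGroups

/-- **`ClassNumberFBQPOfPieces` (stmt-QuantumAdvantage-17903), PROVED**: the four pieces P1–P4 of the BC2
redirect imply the deciding crux `ClassNumberFBQP`. -/
theorem classNumberFBQPOfPieces_proof :
    Summit.QuantumAdvantage.QuantumAdvantage.Theses.DarkClassGroups.ClassNumberFBQPOfPieces := by
  intro h1 h2 h3 h4 _hPCS _hAGO hS
  obtain ⟨C, hC⟩ := h1 hS
  refine h4 ?_ h3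
  refine (h2 C).mono fun x y hy => ?_
  intro hfund
  exact hy hfund (hC _ hfund)

end Summit.QuantumAdvantage.QuantumAdvantage.Theorems.DarkClassGroups
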